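import Summits.QuantumFields.BalabanUV.T4Continuum.Support.NE3QuadRemainderGaugeStep
import Summits.QuantumFields.BalabanUV.T4Continuum.Support.NE3QuadRemainderLocalBox
import Summits.QuantumFields.BalabanUV.T4Continuum.Support.NE3SmoothLiftW
import Summits.QuantumFields.BalabanUV.T4Continuum.Support.NE3FramePotBoundW
import HarnessLib

/-!
# T⁴ programme, node NE3 — route Π, item Π-C-3γ″ (ruling ρ-g26-1 (2); design D-ne3leaf02g8-1 §4 «Γ″ — TOP-LEVEL EXACT COVARIANCE»), file γ-top:
# THE k-FOLD QUADRATIC REMAINDER OF A GAUGED FIELD — if `W·e^{X₀} = (W·e^{B})^{e^{λ}}` then, EXACTLY,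
# `relIter L k W X₀ = log(e^{Ad_{V⁻¹}λ(M•z)}·e^{relIter L k W B}·e^{−λ(M•(z+e_κ))})` and
# `dirIter L k W X₀ = gaugeDir V (λ∘(M•)) + dirIter L k W B + dirIter L k W Q`, `Q := X₀ − gaugeDir W λ − B` the fine three-factor BCH defect;
# hence ON THE FIBRE `‖D_W X₀ − D_W Q‖(z,κ) ≤ C₂·(M·m z κ)² + 10240·(2Λ_c·ρ + Λ_c²)` with `m` the box sup of the SMOOTH companion `B`

NE3 (node U1b) formalisation swarm `b2b-balaban-t4-ne3-formalise-*`, LEAF PROVER 02 (gen 8; Π-C authors' lineage).  WHY (D-ne3r2-g12-1∕-4, D-ne3leaf02g8-1):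
the residual slice representative `X₀` of a minimiser pair is the smooth companion `B = X^free` re-gauged by the pinned-minus-unpinned Landau potential
`λ = −Σ_z g_z h_z` (lattice-Coulomb spikes ∝ L^k at the top corners, visible only in sup currency).  Instead of chasing the spike through the levels, carry
the gauge `u = e^{λ}` EXACTLY to the top: `cavgIter` is covariant under ANY unitary periodic gauge (leaf-01 W1 `cavgIter_gaugeAct`), the linearised
average carries gauge directions to coarse gauge directions exactly (leaf-04 K1 `dirIter_add_gaugeDir`), and the k-fold log-coordinate exponentiates
back (Π-C-3b `cavgIter_vary_eq_vary_relIter_of_tower`).  What is left is (i) the OLD sup-currency remainder of the smooth companion on the box of record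
(Π-C-3e `norm_relIter_sub_dirIter_le_box`, k-free for `B` by D-12-1's numerics), (ii) two ENDS-FORM three-factor BCH errors (file γ23), one at the top bond and
one bondwise in `Q`, and (iii) the linearised average of `Q` — left EXPLICIT here; its Coulomb-profile letter is file γ4″.

CONTENT (0 sorry, 0 def): §1 local letters of the smooth companion by the periodised box restriction (`norm_dirIter_le_box`, `norm_relIter_le_box`); §2 the top-level
log-coordinate as ONE logarithm (`relIter_eq_mlog_top`) and **`relIter_gauged_eq_mlog3`**; §3 the fine identity `eq_mlog3_of_gauged`, the defect bound
`norm_gaugeDefect_le`, **`dirIter_gauged_eq`**; §4 **`norm_dirIter_sub_dirIter_defect_le_of_fibre`** (the END modulo `dirIter L k W Q`).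

HONEST FRAMING.  Kinematics of OUR k-fold block average at one background; the gauged decomposition `(λ, B)`, the classes and the fibre equation are
HYPOTHESES (the leaf (Π-REG-γ″) «gauged two-tier majorant» will supply them per pair; its shape is filed separately); the letter of `dirIter L k W Q` (γ4″)
is NOT here; Π-C-3γ″, (Π-REG-γ″), T-E_w♯ and NE3 are NOT proved; spine PROVED 0∕9; finite T⁴ rung (B)+1 — NOT infinite volume, NOT mass gap, NOT `BetaPertH`,
NOT Clay.  PLACEMENT: `Summits/QuantumFields/BalabanUV/`.  HONEST DEPENDENCY: continuum YM on T⁴ ⇐ BetaPertH ∧ nine spine estimates (0/9 proved); BetaPertH ⇐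
(D1) ∧ (D4) ∧ CAP+tail; G-an2-4 gates asym, D1 and NE2/3/4.
-/

set_option autoImplicit false

open scoped BigOperators Matrix.Norms.L2Operator
open NormedSpace Finset

namespace Summit.QuantumFields.BalabanUV.T4Continuum.NE3QuadRemainderGauged

open Literature.MathematicalPhysics.QuantumFieldTheory.Balaban1983to89
open B7Prop1Explicit B7Prop2Explicit MatrixLog
open B7Prop1Local (InBox loK bondHiK)
open T4AveragingDeficitWall (IsSkewDir IsUnitaryCfg SmallField vary Ad)
open T4AveragingDeficitWallBoundary (IsPeriodicCfg)
open AveragingDeficitPeriodicCounting (IsPeriodicDir)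
open AveragingDeficitChartCalculus (cavg)
open AveragingDeficitMultiLevelPrep (cavgIter LevelSmall tower)
open AveragingDeficitTransport (norm_Ad_of_unitary)
open AveragingDeficitLocality (expUnit_Ad)
open AveragingDeficitPlaqDeriv (vary_isUnitaryCfg)
open BlockAverageVaryDisc (rho0 rho0_pos two_le_nbRad)
open BlockAverageVaryHolo (nbRad)
open BlockAveragePushDirGauge (gaugeDir expGauge)
open NE3TangentCovariantTower (dirIter dirIter_add dirIter_add_gaugeDir)
open NE3LinearisedAverageSup (curvSum levelData norm_dirIter_le_sup)
open NE3QuadRemainderTower (relIter)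
open NE3QuadRemainderSup (norm_relIter_le norm_relIter_sub_dirIter_le cavgIter_vary_eq_vary_relIter_of_tower)
open NE3QuadRemainderFibre (relIter_eq_zero_of_fibre)
open NE3QuadRemainderLocalBox (norm_relIter_sub_dirIter_le_box)
open NE3BoxRestrictionPeriodic (perRestrict norm_perRestrict_le isPeriodicDir_perRestrict isSkewDir_perRestrict dirIter_eq_dirIter_perRestrict
  relIter_eq_relIter_perRestrict)
open NE3CpushGaugeCovariance (cavgIter_gaugeAct)
open NE3SmoothLiftW (tower_eq_pow_mul)
open NE3FramePotBoundW (levelSmall_pred)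
open NE3QuadRemainderGaugeStep (norm_mlog_exp3_sub_le expGauge_one_mem_unitaryUnits)

noncomputable section

variable {d : ℕ} {n : Type*} [Fintype n] [DecidableEq n] [Nonempty n]

/-! ## §1 Local letters of a field on the box of record -/

/-- **THE LINEARISED k-FOLD AVERAGE, BOX-LOCAL SUP FORM**: under Π-C's tower class (`2 ≤ L`, `W` unitary `(L^K·N)`-periodic, `LevelSmall d L K x`,
`SmallField W x`, `curvSum d L K x ≤ (2∕3)L`), for a skew `(L^K·N)`-periodic `Y` with sup `t` over the bonds of the box `[loK L K z, bondHiK L K z κ]`: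
`‖dirIter L K W Y z κ‖ ≤ (3+12d)·L^K·t` (Π-C-1's letter on leaf-04's periodised box restriction). [folklore] -/
theorem norm_dirIter_le_box {L N K : ℕ} [NeZero N] (hL : 2 ≤ L) {W : Site d → Fin d → (Matrix n n ℂ)ˣ} {x : ℝ}
    (hWu : IsUnitaryCfg W) (hWP : IsPeriodicCfg W ((L ^ K * N : ℕ) : ℤ)) (hx : 0 ≤ x) (hsm : LevelSmall d L K x) (hWx : SmallField W x)
    (hA : curvSum d L K x ≤ 2 / 3 * L) {Y : Site d → Fin d → Matrix n n ℂ} (hYs : IsSkewDir Y) (hYP : IsPeriodicDir Y ((L ^ K * N : ℕ) : ℤ))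
    (z : Site d) (κ : Fin d) {t : ℝ} (ht : 0 ≤ t)
    (hdom : ∀ (y : Site d) (μ : Fin d), InBox (loK L K z) (bondHiK L K z κ) y → InBox (loK L K z) (bondHiK L K z κ) (y + e μ) → ‖Y y μ‖ ≤ t) :
    ‖dirIter L K W Y z κ‖ ≤ (3 + 12 * (d : ℝ)) * (L : ℝ) ^ K * t := by
  have hL1 : 1 ≤ L := by omega
  rw [dirIter_eq_dirIter_perRestrict hL1 K ((L ^ K * N : ℕ) : ℤ) W Y z κ]
  have hY's : IsSkewDir (perRestrict ((L ^ K * N : ℕ) : ℤ) (loK L K z) (bondHiK L K z κ) Y) := isSkewDir_perRestrict _ _ _ hYs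
  have hY'P : IsPeriodicDir (perRestrict ((L ^ K * N : ℕ) : ℤ) (loK L K z) (bondHiK L K z κ) Y) ((L ^ K * N : ℕ) : ℤ) :=
    isPeriodicDir_perRestrict _ _ hYP
  have hY'sup := norm_perRestrict_le (P := ((L ^ K * N : ℕ) : ℤ)) hYP ht hdom
  exact NE3QuadRemainderLevels.norm_dirIter_le_sup_at hL hWu hWP hx hsm hWx hA (i := 0) (m := K) (by omega) hY's
    (by rwa [Nat.sub_zero]) ht hY'sup z κ

/-- **THE k-FOLD RELATIVE LOG-COORDINATE, BOX-LOCAL SUP FORM**: same setting, with the box sup `t` obeying the σ-line `4(3+12d)²L^K t ≤ rho0²`: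
`‖relIter L K W Y z κ‖ ≤ 2(3+12d)·L^K·t` (Π-C-3b (i) on the periodised box restriction). [folklore] -/
theorem norm_relIter_le_box {L N K : ℕ} [NeZero N] (hL : 2 ≤ L) {W : Site d → Fin d → (Matrix n n ℂ)ˣ} {x : ℝ}
    (hWu : IsUnitaryCfg W) (hWP : IsPeriodicCfg W ((L ^ K * N : ℕ) : ℤ)) (hx : 0 ≤ x) (hsm : LevelSmall d L K x) (hWx : SmallField W x)
    (hA : curvSum d L K x ≤ 2 / 3 * L) {Y : Site d → Fin d → Matrix n n ℂ} (hYs : IsSkewDir Y) (hYP : IsPeriodicDir Y ((L ^ K * N : ℕ) : ℤ))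
    (z : Site d) (κ : Fin d) {t : ℝ} (ht : 0 ≤ t)
    (hdom : ∀ (y : Site d) (μ : Fin d), InBox (loK L K z) (bondHiK L K z κ) y → InBox (loK L K z) (bondHiK L K z κ) (y + e μ) → ‖Y y μ‖ ≤ t)
    (hσ : 4 * (3 + 12 * (d : ℝ)) ^ 2 * (L : ℝ) ^ K * t ≤ rho0 d L ^ 2) :
    ‖relIter L K W Y z κ‖ ≤ 2 * (3 + 12 * (d : ℝ)) * (L : ℝ) ^ K * t := by
  have hL1 : 1 ≤ L := by omega
  rw [relIter_eq_relIter_perRestrict hL1 K ((L ^ K * N : ℕ) : ℤ) W Y z κ]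
  have hY's : IsSkewDir (perRestrict ((L ^ K * N : ℕ) : ℤ) (loK L K z) (bondHiK L K z κ) Y) := isSkewDir_perRestrict _ _ _ hYs
  have hY'P : IsPeriodicDir (perRestrict ((L ^ K * N : ℕ) : ℤ) (loK L K z) (bondHiK L K z κ) Y) ((L ^ K * N : ℕ) : ℤ) :=
    isPeriodicDir_perRestrict _ _ hYP
  have hY'sup := norm_perRestrict_le (P := ((L ^ K * N : ℕ) : ℤ)) hYP ht hdom
  exact norm_relIter_le hL hWu hWP hx hsm hWx hA hY's hY'P ht hY'sup hσ le_rfl z κ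

/-! ## §2 The top-level log-coordinate as one logarithm, and its gauged form -/

/-- In the σ-regime `2(3+12d)·L^K·s < log 2` (indeed `rho0 ≤ 1∕256`). [folklore] -/
theorem two_mul_sup_lt_log_two {L K : ℕ} (hL : 2 ≤ L) {s : ℝ} (hs : 0 ≤ s) (hσ : 4 * (3 + 12 * (d : ℝ)) ^ 2 * (L : ℝ) ^ K * s ≤ rho0 d L ^ 2) :
    2 * (3 + 12 * (d : ℝ)) * (L : ℝ) ^ K * s < Real.log 2 := by
  have hL1 : 1 ≤ L := by omega
  have hρ : 0 < rho0 d L := rho0_pos (d := d) hL1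
  have hρ1 : rho0 d L ≤ 1 / 256 := by
    have hnb : (2 : ℝ) ≤ nbRad d L := by exact_mod_cast two_le_nbRad (d := d) hL1
    show 1 / (128 * (nbRad d L : ℝ)) ≤ 1 / 256
    exact one_div_le_one_div_of_le (by norm_num) (by linarith)
  have hK : (3 : ℝ) ≤ 3 + 12 * (d : ℝ) := by have : (0:ℝ) ≤ d := Nat.cast_nonneg d; linarith
  have hLK : (1 : ℝ) ≤ (L : ℝ) ^ K := one_le_pow₀ (by exact_mod_cast hL1)
  -- `2(3+12d)L^K s ≤ rho0² ∕ (2(3+12d)) ≤ rho0² ≤ 2⁻¹⁶ < log 2`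
  have h1 : 2 * (3 + 12 * (d : ℝ)) * (L : ℝ) ^ K * s * (2 * (3 + 12 * (d : ℝ))) ≤ rho0 d L ^ 2 := by nlinarith
  have h2 : 2 * (3 + 12 * (d : ℝ)) * (L : ℝ) ^ K * s ≤ rho0 d L ^ 2 := by
    have h6 : (1 : ℝ) ≤ 2 * (3 + 12 * (d : ℝ)) := by linarith
    have h0 : 0 ≤ 2 * (3 + 12 * (d : ℝ)) * (L : ℝ) ^ K * s := by positivity
    nlinarith
  have h3 : rho0 d L ^ 2 ≤ (1 / 256) ^ 2 := pow_le_pow_left₀ hρ.le hρ1 2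
  have h4 := Real.log_two_gt_d9
  nlinarith

/-- **THE TOP-LEVEL LOG-COORDINATE AS ONE LOGARITHM**: in Π-C's tower class and the σ-regime for a skew periodic `X` of global sup `s`,
`relIter L K W X z κ = log( V(z,κ)⁻¹ · \overline{(W e^{X})}^{(K)}(z,κ) )`, `V = cavgIter L K W` (consistency `cavgIter_vary_eq_vary_relIter_of_tower` and
`log ∘ exp = id` on `‖·‖ < log 2`, the coordinate being `≤ 2(3+12d)L^K s`). [folklore] -/
theorem relIter_eq_mlog_top {L N K : ℕ} [NeZero N] (hL : 2 ≤ L) {W : Site d → Fin d → (Matrix n n ℂ)ˣ} {x : ℝ}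
    (hWu : IsUnitaryCfg W) (hWP : IsPeriodicCfg W ((L ^ K * N : ℕ) : ℤ)) (hx : 0 ≤ x) (hsm : LevelSmall d L K x) (hWx : SmallField W x)
    (hA : curvSum d L K x ≤ 2 / 3 * L) {X : Site d → Fin d → Matrix n n ℂ} (hXs : IsSkewDir X) (hXP : IsPeriodicDir X ((L ^ K * N : ℕ) : ℤ))
    {s : ℝ} (hs : 0 ≤ s) (hX : ∀ (y : Site d) (μ : Fin d), ‖X y μ‖ ≤ s) (hσ : 4 * (3 + 12 * (d : ℝ)) ^ 2 * (L : ℝ) ^ K * s ≤ rho0 d L ^ 2)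
    (z : Site d) (κ : Fin d) :
    relIter L K W X z κ
      = mlog ((((cavgIter L K W z κ)⁻¹ : (Matrix n n ℂ)ˣ) : Matrix n n ℂ) * ((cavgIter L K (vary W X 1) z κ : (Matrix n n ℂ)ˣ) : Matrix n n ℂ)) := by
  have hc := cavgIter_vary_eq_vary_relIter_of_tower hL hWu hWP hx hsm hWx hA hXs hXP hs hX hσ (k := K) le_rfl
  have hb : ((cavgIter L K (vary W X 1) z κ : (Matrix n n ℂ)ˣ) : Matrix n n ℂ)
      = ((cavgIter L K W z κ : (Matrix n n ℂ)ˣ) : Matrix n n ℂ) * exp (relIter L K W X z κ) := by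
    have h := congrArg Units.val (congrFun (congrFun hc z) κ)
    simpa only [vary, Units.val_mul, val_expUnit, Complex.ofReal_one, one_smul] using h
  rw [hb, ← mul_assoc, Units.inv_mul, one_mul]
  refine (B7BlockAvgLog.mlog_exp ?_).symm
  exact (norm_relIter_le hL hWu hWP hx hsm hWx hA hXs hXP hs hX hσ le_rfl z κ).trans_lt (two_mul_sup_lt_log_two hL hs hσ)

/-- **THE k-FOLD RELATIVE COORDINATE OF A GAUGED FIELD, EXACTLY.**  Setting: Π-C's tower class at `W` (`K = j+1` levels, period `L^{j+1}·N`); a skew charge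
field `λ` and a skew `(L^{j+1}·N)`-periodic companion `B` of global sup `sB` in the σ-regime, with the GAUGED DECOMPOSITION
`vary W X₀ 1 = gaugeAct (expGauge λ 1) (vary W B 1)`; `X₀` skew periodic of global sup `s₀` in the σ-regime; and the companion configuration `W·e^{B}` in the
multi-level class with some radius `x′` (for the pair: it is a gauge transform of the minimiser `U_A`).  Then at every top bond
`relIter L (j+1) W X₀ z κ = log( e^{Ad_{V(z,κ)⁻¹} λ(M•z)} · e^{relIter L (j+1) W B z κ} · e^{−λ(M•(z+e_κ))} )`, `V = cavgIter L (j+1) W`, `M = L^{j+1}`. [folklore] -/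
theorem relIter_gauged_eq_mlog3 {L N j : ℕ} [NeZero N] (hL : 2 ≤ L) {W : Site d → Fin d → (Matrix n n ℂ)ˣ} {x : ℝ}
    (hWu : IsUnitaryCfg W) (hWP : IsPeriodicCfg W ((L ^ (j + 1) * N : ℕ) : ℤ)) (hx : 0 ≤ x) (hsm : LevelSmall d L (j + 1) x)
    (hWx : SmallField W x) (hA : curvSum d L (j + 1) x ≤ 2 / 3 * L)
    {X₀ : Site d → Fin d → Matrix n n ℂ} (hX₀s : IsSkewDir X₀) (hX₀P : IsPeriodicDir X₀ ((L ^ (j + 1) * N : ℕ) : ℤ))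
    {s₀ : ℝ} (hs₀ : 0 ≤ s₀) (hX₀ : ∀ (y : Site d) (μ : Fin d), ‖X₀ y μ‖ ≤ s₀) (hσ₀ : 4 * (3 + 12 * (d : ℝ)) ^ 2 * (L : ℝ) ^ (j + 1) * s₀ ≤ rho0 d L ^ 2)
    {lam : Site d → Matrix n n ℂ} (hlam : ∀ y, lam y ∈ skewAdjoint (Matrix n n ℂ))
    {B : Site d → Fin d → Matrix n n ℂ} (hBs : IsSkewDir B) (hBP : IsPeriodicDir B ((L ^ (j + 1) * N : ℕ) : ℤ))
    {sB : ℝ} (hsB : 0 ≤ sB) (hB : ∀ (y : Site d) (μ : Fin d), ‖B y μ‖ ≤ sB) (hσB : 4 * (3 + 12 * (d : ℝ)) ^ 2 * (L : ℝ) ^ (j + 1) * sB ≤ rho0 d L ^ 2)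
    (hE : vary W X₀ 1 = gaugeAct (expGauge lam 1) (vary W B 1))
    {x' : ℝ} (hx' : 0 ≤ x') (hsm' : LevelSmall d L j x') (hZx' : SmallField (vary W B 1) x')
    (z : Site d) (κ : Fin d) :
    relIter L (j + 1) W X₀ z κ
      = mlog (exp (Ad (cavgIter L (j + 1) W z κ)⁻¹ (lam (((L : ℤ) ^ (j + 1)) • z))) * exp (relIter L (j + 1) W B z κ)
          * exp (-(lam (((L : ℤ) ^ (j + 1)) • (z + e κ))))) := by
  have hL1 : 1 ≤ L := by omega
  rw [relIter_eq_mlog_top hL hWu hWP hx hsm hWx hA hX₀s hX₀P hs₀ hX₀ hσ₀ z κ, hE]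
  -- covariance of the k-fold average under the gauge `e^{λ}`
  have hZu : IsUnitaryCfg (vary W B 1) := vary_isUnitaryCfg hWu hBs 1
  have hu : ∀ y, expGauge lam 1 y ∈ unitaryUnits (Matrix n n ℂ) := expGauge_one_mem_unitaryUnits hlam
  have hcov := cavgIter_gaugeAct hL1 j hZu hx' hsm' hZx' hu
  rw [hcov]
  -- consistency for the companion
  have hc := cavgIter_vary_eq_vary_relIter_of_tower hL hWu hWP hx hsm hWx hA hBs hBP hsB hB hσB (k := j + 1) le_rfl
  have hb : ((cavgIter L (j + 1) (vary W B 1) z κ : (Matrix n n ℂ)ˣ) : Matrix n n ℂ)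
      = ((cavgIter L (j + 1) W z κ : (Matrix n n ℂ)ˣ) : Matrix n n ℂ) * exp (relIter L (j + 1) W B z κ) := by
    have h := congrArg Units.val (congrFun (congrFun hc z) κ)
    simpa only [vary, Units.val_mul, val_expUnit, Complex.ofReal_one, one_smul] using h
  simp only [gaugeAct, expGauge, Units.val_mul, val_expUnit, val_inv_expUnit, Complex.ofReal_one, one_smul]
  rw [hb]
  have hAd : exp (Ad (cavgIter L (j + 1) W z κ)⁻¹ (lam (((L : ℤ) ^ (j + 1)) • z)))
      = (((cavgIter L (j + 1) W z κ)⁻¹ : (Matrix n n ℂ)ˣ) : Matrix n n ℂ) * exp (lam (((L : ℤ) ^ (j + 1)) • z))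
          * ((cavgIter L (j + 1) W z κ : (Matrix n n ℂ)ˣ) : Matrix n n ℂ) := by
    have h := congrArg Units.val (expUnit_Ad (cavgIter L (j + 1) W z κ)⁻¹ (lam (((L : ℤ) ^ (j + 1)) • z)))
    simpa only [val_expUnit, Units.val_mul, inv_inv] using h
  rw [hAd]
  simp only [mul_assoc]

/-! ## §3 The fine identity, the defect, and the linearised average of a gauged field -/

omit [Nonempty n] in
/-- **THE GAUGED FIELD AS A THREE-FACTOR LOGARITHM, BONDWISE**: from `vary W X₀ 1 = gaugeAct (expGauge λ 1) (vary W B 1)` and `‖X₀‖ < log 2`: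
`X₀(b) = log( e^{Ad_{W(b)⁻¹}λ(x)} · e^{B(b)} · e^{−λ(x+e_μ)} )`. [folklore] -/
theorem eq_mlog3_of_gauged {W : Site d → Fin d → (Matrix n n ℂ)ˣ} {X₀ B : Site d → Fin d → Matrix n n ℂ} {lam : Site d → Matrix n n ℂ}
    (hE : vary W X₀ 1 = gaugeAct (expGauge lam 1) (vary W B 1)) (y : Site d) (μ : Fin d) (hX₀ : ‖X₀ y μ‖ < Real.log 2) :
    X₀ y μ = mlog (exp (Ad (W y μ)⁻¹ (lam y)) * exp (B y μ) * exp (-(lam (y + e μ)))) := by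
  have h := congrArg Units.val (congrFun (congrFun hE y) μ)
  simp only [vary, gaugeAct, expGauge, Units.val_mul, val_expUnit, val_inv_expUnit, Complex.ofReal_one, one_smul] at h
  -- `W e^{X₀} = e^{λ} W e^{B} e^{−λ₊}` ⇒ `e^{X₀} = (W⁻¹ e^{λ} W) e^{B} e^{−λ₊}`
  have h2 : exp (X₀ y μ) = (((W y μ)⁻¹ : (Matrix n n ℂ)ˣ) : Matrix n n ℂ) * exp (lam y) * ((W y μ : (Matrix n n ℂ)ˣ) : Matrix n n ℂ)
      * exp (B y μ) * exp (-(lam (y + e μ))) := by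
    have h3 := congrArg (fun A => (((W y μ)⁻¹ : (Matrix n n ℂ)ˣ) : Matrix n n ℂ) * A) h
    simp only [← mul_assoc, Units.inv_mul, one_mul] at h3
    rw [h3]
  have hAd : exp (Ad (W y μ)⁻¹ (lam y))
      = (((W y μ)⁻¹ : (Matrix n n ℂ)ˣ) : Matrix n n ℂ) * exp (lam y) * ((W y μ : (Matrix n n ℂ)ˣ) : Matrix n n ℂ) := by
    have h := congrArg Units.val (expUnit_Ad (W y μ)⁻¹ (lam y))
    simpa only [val_expUnit, Units.val_mul, inv_inv] using h
  rw [hAd, ← h2]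
  exact (B7BlockAvgLog.mlog_exp hX₀).symm

/-- **THE GAUGE DEFECT IS ENDS-FORM SMALL**: `Q(b) := X₀(b) − (gaugeDir W λ (b) + B(b))` obeys
`‖Q(b)‖ ≤ 10240·(‖λ(x)‖‖B(b)‖ + ‖λ(x)‖‖λ(x+e_μ)‖ + ‖B(b)‖‖λ(x+e_μ)‖)` for `W` unitary and charges∕companion below `1∕8192` (file γ23's three-factor letter).
[folklore] -/
theorem norm_gaugeDefect_le {W : Site d → Fin d → (Matrix n n ℂ)ˣ} (hWu : IsUnitaryCfg W) {X₀ B : Site d → Fin d → Matrix n n ℂ}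
    {lam : Site d → Matrix n n ℂ} (hE : vary W X₀ 1 = gaugeAct (expGauge lam 1) (vary W B 1)) (y : Site d) (μ : Fin d)
    (hX₀ : ‖X₀ y μ‖ < Real.log 2) (hl : ‖lam y‖ ≤ 1 / 8192) (hl' : ‖lam (y + e μ)‖ ≤ 1 / 8192) (hB : ‖B y μ‖ ≤ 1 / 8192) :
    ‖X₀ y μ - (gaugeDir W lam y μ + B y μ)‖
      ≤ 10240 * (‖lam y‖ * ‖B y μ‖ + ‖lam y‖ * ‖lam (y + e μ)‖ + ‖B y μ‖ * ‖lam (y + e μ)‖) := by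
  rw [eq_mlog3_of_gauged hE y μ hX₀]
  have hna : ‖Ad (W y μ)⁻¹ (lam y)‖ = ‖lam y‖ := norm_Ad_of_unitary ((unitaryUnits _).inv_mem (hWu y μ)) _
  have h := norm_mlog_exp3_sub_le (a := Ad (W y μ)⁻¹ (lam y)) (ρ := B y μ) (b := lam (y + e μ)) (by rw [hna]; exact hl) hB hl'
  rw [hna] at h
  have hid : Ad (W y μ)⁻¹ (lam y) + B y μ - lam (y + e μ) = gaugeDir W lam y μ + B y μ := by simp only [gaugeDir]; abel
  rw [hid] at h
  exact h

/-- **THE LINEARISED k-FOLD AVERAGE OF A GAUGED FIELD**: in leaf-04's tower class (`1 ≤ L`, `W` unitary `tower L N (j+1)`-periodic, `LevelSmall d L j x`,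
`SmallField W x`), for a skew `tower L N (j+1)`-periodic charge field `λ` and any `X₀`, `B`:
`dirIter L (j+1) W X₀ = gaugeDir (cavgIter L (j+1) W) (λ ∘ (L^{j+1}•)) + dirIter L (j+1) W B + dirIter L (j+1) W Q`, `Q = X₀ − gaugeDir W λ − B`
(K1 through the tower `dirIter_add_gaugeDir` + additivity). [folklore] -/
theorem dirIter_gauged_eq {L N j : ℕ} [NeZero N] (hL : 1 ≤ L) {W : Site d → Fin d → (Matrix n n ℂ)ˣ} {x : ℝ} (hWu : IsUnitaryCfg W)
    (hWP : IsPeriodicCfg W ((tower L N (j + 1) : ℕ) : ℤ)) (hx : 0 ≤ x) (hs : LevelSmall d L j x) (hWx : SmallField W x)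
    (X₀ B : Site d → Fin d → Matrix n n ℂ) {lam : Site d → Matrix n n ℂ} (hlam : ∀ y, lam y ∈ skewAdjoint (Matrix n n ℂ))
    (hlamP : ∀ (y : Site d) (i : Fin d), lam (y + ((tower L N (j + 1) : ℕ) : ℤ) • e i) = lam y) (z : Site d) (κ : Fin d) :
    dirIter L (j + 1) W X₀ z κ
      = gaugeDir (cavgIter L (j + 1) W) (fun y => lam (((L : ℤ) ^ (j + 1)) • y)) z κ + dirIter L (j + 1) W B z κ
        + dirIter L (j + 1) W (fun y μ => X₀ y μ - (gaugeDir W lam y μ + B y μ)) z κ := by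
  set Q : Site d → Fin d → Matrix n n ℂ := fun y μ => X₀ y μ - (gaugeDir W lam y μ + B y μ) with hQ
  have hX : X₀ = fun y ν => (B y ν + Q y ν) + gaugeDir W lam y ν := by
    funext y ν; simp only [hQ]; abel
  have h1 : dirIter L (j + 1) W X₀ z κ = dirIter L (j + 1) W (fun y ν => (B y ν + Q y ν) + gaugeDir W lam y ν) z κ := by
    rw [← hX]
  have h2 := congrFun (congrFun (dirIter_add_gaugeDir (M := N) hL j hWu hWP hx hs hWx (fun y ν => B y ν + Q y ν) hlam hlamP) z) κ
  have h3 := congrFun (congrFun (dirIter_add hL j hWu hx hs hWx B Q) z) κ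
  rw [h1, h2, h3]
  abel

/-! ## §4 The END modulo the linearised average of the defect -/

/-- **ON THE FIBRE, THE LINEARISED AVERAGE OF A GAUGED FIELD IS QUADRATICALLY SMALL UP TO THE DEFECT TERM.**  Setting of `relIter_gauged_eq_mlog3`, plus:
charges `‖λ‖ ≤ 1∕8192` and `(L^{j+1}·N)`-periodic, the box sup `m ≥ 0` of the companion `B` on the box of record of `(z,κ)` with its σ-line and
`2(3+12d)L^{j+1}m ≤ 1∕8192`, and the fibre equation `cavgIter L (j+1) (vary W X₀ 1) = cavgIter L (j+1) W`.  Then, with `Q := X₀ − gaugeDir W λ − B`,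
`V = cavgIter L (j+1) W`, `Λ₋ = ‖λ(M•z)‖`, `Λ₊ = ‖λ(M•(z+e_κ))‖`:
`‖dirIter L (j+1) W X₀ z κ − dirIter L (j+1) W Q z κ‖ ≤ 4(3+12d)³∕rho0²·(L^{j+1}·m)² + 10240·(2(3+12d)L^{j+1}m·(Λ₋ + Λ₊) + Λ₋Λ₊)`. [folklore] -/
theorem norm_dirIter_sub_dirIter_defect_le_of_fibre {L N j : ℕ} [NeZero N] (hL : 2 ≤ L) {W : Site d → Fin d → (Matrix n n ℂ)ˣ} {x : ℝ}
    (hWu : IsUnitaryCfg W) (hWP : IsPeriodicCfg W ((L ^ (j + 1) * N : ℕ) : ℤ)) (hx : 0 ≤ x) (hsm : LevelSmall d L (j + 1) x)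
    (hWx : SmallField W x) (hA : curvSum d L (j + 1) x ≤ 2 / 3 * L)
    {X₀ : Site d → Fin d → Matrix n n ℂ} (hX₀s : IsSkewDir X₀) (hX₀P : IsPeriodicDir X₀ ((L ^ (j + 1) * N : ℕ) : ℤ))
    {s₀ : ℝ} (hs₀ : 0 ≤ s₀) (hX₀ : ∀ (y : Site d) (μ : Fin d), ‖X₀ y μ‖ ≤ s₀) (hσ₀ : 4 * (3 + 12 * (d : ℝ)) ^ 2 * (L : ℝ) ^ (j + 1) * s₀ ≤ rho0 d L ^ 2)
    {lam : Site d → Matrix n n ℂ} (hlam : ∀ y, lam y ∈ skewAdjoint (Matrix n n ℂ)) (hlams : ∀ y, ‖lam y‖ ≤ 1 / 8192)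
    (hlamP : ∀ (y : Site d) (i : Fin d), lam (y + ((L ^ (j + 1) * N : ℕ) : ℤ) • e i) = lam y)
    {B : Site d → Fin d → Matrix n n ℂ} (hBs : IsSkewDir B) (hBP : IsPeriodicDir B ((L ^ (j + 1) * N : ℕ) : ℤ))
    {sB : ℝ} (hsB : 0 ≤ sB) (hB : ∀ (y : Site d) (μ : Fin d), ‖B y μ‖ ≤ sB) (hσB : 4 * (3 + 12 * (d : ℝ)) ^ 2 * (L : ℝ) ^ (j + 1) * sB ≤ rho0 d L ^ 2)
    (hE : vary W X₀ 1 = gaugeAct (expGauge lam 1) (vary W B 1))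
    {x' : ℝ} (hx' : 0 ≤ x') (hsm' : LevelSmall d L j x') (hZx' : SmallField (vary W B 1) x')
    (hfib : cavgIter L (j + 1) (vary W X₀ 1) = cavgIter L (j + 1) W)
    (z : Site d) (κ : Fin d) {m : ℝ} (hm : 0 ≤ m)
    (hdom : ∀ (y : Site d) (μ : Fin d), InBox (loK L (j + 1) z) (bondHiK L (j + 1) z κ) y →
      InBox (loK L (j + 1) z) (bondHiK L (j + 1) z κ) (y + e μ) → ‖B y μ‖ ≤ m)
    (hσm : 4 * (3 + 12 * (d : ℝ)) ^ 2 * (L : ℝ) ^ (j + 1) * m ≤ rho0 d L ^ 2) (hm' : 2 * (3 + 12 * (d : ℝ)) * (L : ℝ) ^ (j + 1) * m ≤ 1 / 8192) :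
    ‖dirIter L (j + 1) W X₀ z κ - dirIter L (j + 1) W (fun y μ => X₀ y μ - (gaugeDir W lam y μ + B y μ)) z κ‖
      ≤ 4 * (3 + 12 * (d : ℝ)) ^ 3 / rho0 d L ^ 2 * ((L : ℝ) ^ (j + 1) * m) ^ 2
        + 10240 * (2 * (3 + 12 * (d : ℝ)) * (L : ℝ) ^ (j + 1) * m * (‖lam (((L : ℤ) ^ (j + 1)) • z)‖ + ‖lam (((L : ℤ) ^ (j + 1)) • (z + e κ))‖)
          + ‖lam (((L : ℤ) ^ (j + 1)) • z)‖ * ‖lam (((L : ℤ) ^ (j + 1)) • (z + e κ))‖) := by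
  have hL1 : 1 ≤ L := by omega
  -- periods in `tower` spelling for leaf-04's tower lemmas
  have htow : ((tower L N (j + 1) : ℕ) : ℤ) = ((L ^ (j + 1) * N : ℕ) : ℤ) := by rw [tower_eq_pow_mul]
  have hWP' : IsPeriodicCfg W ((tower L N (j + 1) : ℕ) : ℤ) := by rw [htow]; exact hWP
  have hlamP' : ∀ (y : Site d) (i : Fin d), lam (y + ((tower L N (j + 1) : ℕ) : ℤ) • e i) = lam y := by rw [htow]; exact hlamP
  -- abbreviations
  set V := cavgIter L (j + 1) W with hV
  set a : Matrix n n ℂ := Ad (V z κ)⁻¹ (lam (((L : ℤ) ^ (j + 1)) • z)) with ha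
  set b : Matrix n n ℂ := lam (((L : ℤ) ^ (j + 1)) • (z + e κ)) with hb
  set ρ : Matrix n n ℂ := relIter L (j + 1) W B z κ with hρ
  -- (1) the fibre: `0 = log(e^{a} e^{ρ} e^{−b})`, hence `‖a + ρ − b‖` is ends-form small
  have h0 : relIter L (j + 1) W X₀ z κ = 0 :=
    relIter_eq_zero_of_fibre hL hWu hWP hx hsm hWx hA hX₀s hX₀P hs₀ hX₀ hσ₀ hfib z κ
  have h3 := relIter_gauged_eq_mlog3 hL hWu hWP hx hsm hWx hA hX₀s hX₀P hs₀ hX₀ hσ₀ hlam hBs hBP hsB hB hσB hE hx' hsm' hZx' z κ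
  rw [h0] at h3
  have hVu : V z κ ∈ unitaryUnits (Matrix n n ℂ) := (levelData hL1 hWu hx (levelSmall_pred j hsm) hWx (m := j + 1) le_rfl).1 z κ
  have hna : ‖a‖ = ‖lam (((L : ℤ) ^ (j + 1)) • z)‖ := norm_Ad_of_unitary ((unitaryUnits _).inv_mem hVu) _
  have hρn : ‖ρ‖ ≤ 2 * (3 + 12 * (d : ℝ)) * (L : ℝ) ^ (j + 1) * m :=
    norm_relIter_le_box hL hWu hWP hx hsm hWx hA hBs hBP z κ hm hdom hσm
  have hρs : ‖ρ‖ ≤ 1 / 8192 := hρn.trans hm'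
  have hT := norm_mlog_exp3_sub_le (a := a) (ρ := ρ) (b := b) (by rw [hna]; exact hlams _) hρs (hlams _)
  rw [← h3, zero_sub, norm_neg] at hT
  -- (2) the linear split and the remainder of the companion
  have hD := dirIter_gauged_eq (N := N) hL1 hWu hWP' hx (levelSmall_pred j hsm) hWx X₀ B hlam hlamP' z κ
  have hC : ‖relIter L (j + 1) W B z κ - dirIter L (j + 1) W B z κ‖ ≤ 4 * (3 + 12 * (d : ℝ)) ^ 3 / rho0 d L ^ 2 * ((L : ℝ) ^ (j + 1) * m) ^ 2 :=
    norm_relIter_sub_dirIter_le_box hL hWu hWP hx hsm hWx hA hBs hBP (k := j + 1) le_rfl z κ hm hdom hσm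
  have hgd : gaugeDir V (fun y => lam (((L : ℤ) ^ (j + 1)) • y)) z κ = a - b := by simp only [gaugeDir, ha, hb]
  -- `D X₀ − D Q = (a − b) + D B = (a + ρ − b) − (ρ − D B)`
  have hid : dirIter L (j + 1) W X₀ z κ - dirIter L (j + 1) W (fun y μ => X₀ y μ - (gaugeDir W lam y μ + B y μ)) z κ
      = (a + ρ - b) - (relIter L (j + 1) W B z κ - dirIter L (j + 1) W B z κ) := by
    rw [hD, hgd, hρ]; abel
  rw [hid]
  have hρ0 := norm_nonneg ρ
  have hl0 := norm_nonneg (lam (((L : ℤ) ^ (j + 1)) • z))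
  have hl0' := norm_nonneg (lam (((L : ℤ) ^ (j + 1)) • (z + e κ)))
  calc ‖(a + ρ - b) - (relIter L (j + 1) W B z κ - dirIter L (j + 1) W B z κ)‖
      ≤ ‖a + ρ - b‖ + ‖relIter L (j + 1) W B z κ - dirIter L (j + 1) W B z κ‖ := norm_sub_le _ _
    _ ≤ 10240 * (‖a‖ * ‖ρ‖ + ‖a‖ * ‖b‖ + ‖ρ‖ * ‖b‖) + 4 * (3 + 12 * (d : ℝ)) ^ 3 / rho0 d L ^ 2 * ((L : ℝ) ^ (j + 1) * m) ^ 2 :=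
        add_le_add hT hC
    _ ≤ _ := by
        rw [hna, hb]
        have e1 : ‖lam (((L : ℤ) ^ (j + 1)) • z)‖ * ‖ρ‖ ≤ ‖lam (((L : ℤ) ^ (j + 1)) • z)‖ * (2 * (3 + 12 * (d : ℝ)) * (L : ℝ) ^ (j + 1) * m) :=
          mul_le_mul_of_nonneg_left hρn hl0
        have e2 : ‖ρ‖ * ‖lam (((L : ℤ) ^ (j + 1)) • (z + e κ))‖ ≤ (2 * (3 + 12 * (d : ℝ)) * (L : ℝ) ^ (j + 1) * m) * ‖lam (((L : ℤ) ^ (j + 1)) • (z + e κ))‖ :=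
          mul_le_mul_of_nonneg_right hρn hl0'
        nlinarith [e1, e2, mul_nonneg hl0 hl0']

end

end Summit.QuantumFields.BalabanUV.T4Continuum.NE3QuadRemainderGauged
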